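import Summits.Ventures.HodgeRepro2.T6A2WeilIdent

/-!
# T6A2WeilGrading — the full-ring identification `H^*(B, ℚ) ≃ HB K` and its grading

Cell pub-hodge-repro2, Tier 6 (README §10), seat t6-p2 (A2 host side; continues T6A2WeilIdent). For the A2
situation `D` on the host, the A1-side datum `A : OrderAction W D.B K` and the Lange display binder
`hL : Function.Bijective (langeMap W D.B)`:
* `extEquiv e : ⋀ M ≃ₐ[ℚ] ⋀ N` for a linear equivalence `e : M ≃ₗ N` (`ExteriorAlgebra.map` both ways);
* `evF W D A hL : FullRing W D.B ≃ₐ[ℚ] HB K := langeEquiv⁻¹ then ⋀(φ₁⁻¹)`, with `evOf = evF ∘ evenToFull`;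
* THE GRADING of `langeMap` (both directions): `langeMap_mem_range_ofDegF` (a class of exterior degree `n`
  maps into cohomological degree `n`) and `mem_exteriorPower_of_langeMap_mem` (conversely, by the uniqueness
  of the homogeneous decomposition and the injectivity of `langeMap`), hence `evF_symm_mem_range_ofDegF` /
  `evF_ofDegF_mem_degB`: `evF` identifies `H^n(B, ℚ)` with `degB K n = ⋀^n H1 K`.
No `sorry`; standard axioms. §8(d): uses an L-value-free non-vanishing device: NO.
-/

noncomputable section

namespace Summit.Ventures.HodgeRepro2.T6.WeilInst

open HostAPI.Carriers.AlgebraicGeometry.Motives CategoryTheory Opposite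
open Summit.Ventures.HodgeRepro2.T6 Summit.Ventures.HodgeRepro2.T6.A2Gysin
  Summit.Ventures.HodgeRepro2.T6.A2Shadow
open scoped DirectSum

universe u

section extEquiv

variable {M N : Type*} [AddCommGroup M] [Module ℚ M] [AddCommGroup N] [Module ℚ N]

/-- the exterior-algebra map of a linear equivalence is an algebra equivalence -/
def extEquiv (e : M ≃ₗ[ℚ] N) : ExteriorAlgebra ℚ M ≃ₐ[ℚ] ExteriorAlgebra ℚ N :=
  AlgEquiv.ofAlgHom (ExteriorAlgebra.map (e : M →ₗ[ℚ] N)) (ExteriorAlgebra.map (e.symm : N →ₗ[ℚ] M))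
    (by
      rw [ExteriorAlgebra.map_comp_map]
      convert ExteriorAlgebra.map_id (R := ℚ) (M := N)
      exact LinearMap.ext fun n => e.apply_symm_apply n)
    (by
      rw [ExteriorAlgebra.map_comp_map]
      convert ExteriorAlgebra.map_id (R := ℚ) (M := M)
      exact LinearMap.ext fun m => e.symm_apply_apply m)

/-- `extEquiv e` is `ExteriorAlgebra.map e` -/
theorem extEquiv_apply (e : M ≃ₗ[ℚ] N) (t : ExteriorAlgebra ℚ M) :
    extEquiv e t = ExteriorAlgebra.map (e : M →ₗ[ℚ] N) t := rfl

/-- `(extEquiv e).symm` is `ExteriorAlgebra.map e.symm` -/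
theorem extEquiv_symm_apply (e : M ≃ₗ[ℚ] N) (t : ExteriorAlgebra ℚ N) :
    (extEquiv e).symm t = ExteriorAlgebra.map (e.symm : N →ₗ[ℚ] M) t := rfl

/-- `ExteriorAlgebra.map` preserves the exterior degree -/
theorem map_mem_exteriorPower (f : M →ₗ[ℚ] N) {n : ℕ} {t : ExteriorAlgebra ℚ M} (ht : t ∈ ⋀[ℚ]^n M) :
    ExteriorAlgebra.map f t ∈ ⋀[ℚ]^n N := by
  rw [← ExteriorAlgebra.ιMulti_span_fixedDegree] at ht ⊢
  refine Submodule.span_induction (p := fun t _ => ExteriorAlgebra.map f t ∈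
    Submodule.span ℚ (Set.range (ExteriorAlgebra.ιMulti ℚ n))) ?_ ?_ ?_ ?_ ht
  · rintro _ ⟨v, rfl⟩
    rw [ExteriorAlgebra.map_apply_ιMulti]
    exact Submodule.subset_span ⟨_, rfl⟩
  · simp
  · intro a b _ _ ha hb; rw [map_add]; exact Submodule.add_mem _ ha hb
  · intro q a _ ha; rw [map_smul]; exact Submodule.smul_mem _ _ ha

end extEquiv

variable {k : Type u} [Field k] (W : WeilCohomology k ℚ)

section grading

variable (P : SPVar k)

/-- a component of `ofDegF i a` off the degree `i` vanishes -/
theorem ofDegF_apply_of_ne {i j : ℕ} (h : j ≠ i) (a : W.obj P.X i) : (ofDegF W P i a) j = 0 := by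
  rw [ofDegF, DirectSum.lof_eq_of, DirectSum.of_eq_of_ne _ _ _ h]

/-- the degree-`i` component of `ofDegF i a` is `a` -/
theorem ofDegF_apply_same (i : ℕ) (a : W.obj P.X i) : (ofDegF W P i a) i = a := by
  rw [ofDegF, DirectSum.lof_eq_of, DirectSum.of_eq_same]

/-- an element whose components off `i` vanish is `ofDegF i` of its `i`-component -/
theorem eq_ofDegF_of_forall_ne {i : ℕ} (x : FullRing W P) (hx : ∀ j ≠ i, x j = 0) :
    x = ofDegF W P i (x i) := by
  classical
  refine DirectSum.ext _ fun j => ?_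
  by_cases hj : j = i
  · subst hj; rw [ofDegF_apply_same]
  · rw [hx j hj, ofDegF_apply_of_ne W P hj]

/-- a product of degree-one classes lies in the degree given by its length -/
theorem list_prod_mem_range_ofDegF (l : List (W.obj P.X 1)) :
    (l.map (ι₁ W P)).prod ∈ LinearMap.range (ofDegF W P l.length) := by
  induction l with
  | nil => exact ⟨W.one P.X, rfl⟩
  | cons a l ih =>
    obtain ⟨y, hy⟩ := ih
    refine ⟨castDeg W (by omega : 1 + l.length = l.length + 1) (W.cup rfl a y), ?_⟩
    change ofDegF W P (l.length + 1) _ = (List.map (ι₁ W P) (a :: l)).prod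
    rw [ofDegF_castDeg, List.map_cons, List.prod_cons, ← hy, ι₁, ofDegF_mul_ofDegF]

/-- `langeMap` of an exterior monomial of length `n` has degree `n` -/
theorem langeMap_ιMulti_mem (n : ℕ) (v : Fin n → W.obj P.X 1) :
    langeMap W P (ExteriorAlgebra.ιMulti ℚ n v) ∈ LinearMap.range (ofDegF W P n) := by
  have h := list_prod_mem_range_ofDegF W P (List.ofFn v)
  rw [List.length_ofFn] at h
  have hl : (List.ofFn fun i => ExteriorAlgebra.ι ℚ (v i)).map (langeMap W P) = (List.ofFn v).map (ι₁ W P) := by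
    simp [List.map_ofFn, Function.comp_def]
  rw [ExteriorAlgebra.ιMulti_apply, map_list_prod, hl]
  exact h

/-- THE GRADING OF `langeMap`, forward: exterior degree `n` maps into cohomological degree `n` -/
theorem langeMap_mem_range_ofDegF {n : ℕ} {t : ExteriorAlgebra ℚ (W.obj P.X 1)} (ht : t ∈ ⋀[ℚ]^n (W.obj P.X 1)) :
    langeMap W P t ∈ LinearMap.range (ofDegF W P n) := by
  rw [← ExteriorAlgebra.ιMulti_span_fixedDegree] at ht
  refine Submodule.span_induction (p := fun t _ => langeMap W P t ∈ LinearMap.range (ofDegF W P n))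
    ?_ ?_ ?_ ?_ ht
  · rintro _ ⟨v, rfl⟩; exact langeMap_ιMulti_mem W P n v
  · simp
  · intro a b _ _ ha hb; rw [map_add]; exact Submodule.add_mem _ ha hb
  · intro q a _ ha; rw [map_smul]; exact Submodule.smul_mem _ _ ha

/-- THE GRADING OF `langeMap`, backward (for an injective `langeMap`): a class whose image has cohomological
degree `n` has exterior degree `n` — by the uniqueness of the homogeneous decomposition of `⋀ H¹`. -/
theorem mem_exteriorPower_of_langeMap_mem (hinj : Function.Injective (langeMap W P)) {n : ℕ}
    {t : ExteriorAlgebra ℚ (W.obj P.X 1)} (ht : langeMap W P t ∈ LinearMap.range (ofDegF W P n)) :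
    t ∈ ⋀[ℚ]^n (W.obj P.X 1) := by
  classical
  let ℳ : ℕ → Submodule ℚ (ExteriorAlgebra ℚ (W.obj P.X 1)) := fun i => ⋀[ℚ]^i (W.obj P.X 1)
  obtain ⟨a, ha⟩ := ht
  -- the homogeneous components of `t`
  have hdec := DirectSum.sum_support_decompose ℳ t
  -- each component maps into its degree
  have hcomp : ∀ j, ∃ y : W.obj P.X j, langeMap W P (DirectSum.decompose ℳ t j : ExteriorAlgebra ℚ _) =
      ofDegF W P j y := fun j => by
    obtain ⟨y, hy⟩ := langeMap_mem_range_ofDegF W P (DirectSum.decompose ℳ t j).2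
    exact ⟨y, hy.symm⟩
  choose y hy using hcomp
  -- the components off `n` vanish
  have hzero : ∀ j ≠ n, (DirectSum.decompose ℳ t j : ExteriorAlgebra ℚ (W.obj P.X 1)) = 0 := by
    intro j hj
    by_cases hjs : j ∈ (DirectSum.decompose ℳ t).support
    · apply hinj
      rw [map_zero, hy j]
      have h1 : (langeMap W P t) j = 0 := by rw [← ha, ofDegF_apply_of_ne W P hj]
      rw [← hdec, map_sum] at h1
      simp only [hy] at h1
      rw [DirectSum.sum_apply] at h1
      rw [Finset.sum_eq_single j (fun i _ hi => ofDegF_apply_of_ne W P hi.symm _)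
        (fun h => absurd hjs h), ofDegF_apply_same] at h1
      rw [h1, map_zero]
    · rw [DFinsupp.notMem_support_iff.1 hjs]
      rfl
  rw [← hdec, Finset.sum_eq_single n (fun j _ hj => hzero j hj)
    (fun hn => by rw [DFinsupp.notMem_support_iff.1 hn]; rfl)]
  exact (DirectSum.decompose ℳ t n).2

end grading

section evF

variable {K : Type*} [Field K] [NumberField K] (D : SituationData k) (A : OrderAction W D.B K)
  (hL : Function.Bijective (langeMap W D.B))

/-- THE FULL-RING IDENTIFICATION `H^*(B, ℚ) ≃ HB K = ⋀ H1 K`: `langeMap⁻¹` then `⋀(φ₁⁻¹)`. -/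
def evF : FullRing W D.B ≃ₐ[ℚ] HB K :=
  (langeEquiv W D hL).symm.trans (extEquiv A.φ₁.symm)

/-- `evF`, unfolded -/
theorem evF_apply (y : FullRing W D.B) :
    evF W D A hL y = ExteriorAlgebra.map (A.φ₁.symm : W.obj D.B.X 1 →ₗ[ℚ] H1 K) ((langeEquiv W D hL).symm y) := rfl

/-- `evF.symm`, unfolded -/
theorem evF_symm_apply (u : HB K) :
    (evF W D A hL).symm u = langeMap W D.B (ExteriorAlgebra.map (A.φ₁ : H1 K →ₗ[ℚ] W.obj D.B.X 1) u) := rfl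

/-- `evOf = evF ∘ evenToFull` -/
theorem evOf_eq_evF (a : EvenRing W D.B) : evOf W D A hL a = evF W D A hL (evenToFull W D.B a) := rfl

/-- the inverse identification sends `degB K n` into cohomological degree `n` -/
theorem evF_symm_mem_range_ofDegF {n : ℕ} {u : HB K} (hu : u ∈ degB K n) :
    (evF W D A hL).symm u ∈ LinearMap.range (ofDegF W D.B n) := by
  rw [evF_symm_apply]
  exact langeMap_mem_range_ofDegF W D.B (map_mem_exteriorPower _ hu)

/-- the identification sends cohomological degree `n` into `degB K n` -/
theorem evF_ofDegF_mem_degB (n : ℕ) (a : W.obj D.B.X n) : evF W D A hL (ofDegF W D.B n a) ∈ degB K n := by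
  rw [evF_apply]
  refine map_mem_exteriorPower _ ?_
  refine mem_exteriorPower_of_langeMap_mem W D.B hL.1 ?_
  rw [← langeEquiv_apply W D hL, AlgEquiv.apply_symm_apply]
  exact ⟨a, rfl⟩

/-- `ev a ∈ degB K (2k)` forces `a` to be homogeneous of degree `k` in the even ring -/
theorem exists_eq_ofDeg_of_evOf_mem {k' : ℕ} {a : EvenRing W D.B} (ha : evOf W D A hL a ∈ degB K (2 * k')) :
    ∃ a' : Ev W D.B.X k', a = ofDeg W D.B k' a' := by
  rw [evOf_eq_evF] at ha
  have h := evF_symm_mem_range_ofDegF W D A hL ha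
  rw [AlgEquiv.symm_apply_apply] at h
  obtain ⟨a', ha'⟩ := h
  refine ⟨a', ?_⟩
  -- `evenToFull` is injective: compare components
  have hinj : Function.Injective (evenToFull W D.B) := by
    intro x y hxy
    refine DirectSum.ext _ fun i => ?_
    have := congrArg (fun z : FullRing W D.B => z (2 * i)) hxy
    simp only at this
    rw [eq_sum_ofDeg W D.B x, eq_sum_ofDeg W D.B y, map_sum, map_sum] at this
    simp only [evenToFull_ofDeg] at this
    classical
    rw [DirectSum.sum_apply, DirectSum.sum_apply] at this
    by_cases hi : i ∈ Finset.range (D.B.n + 1)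
    · rw [Finset.sum_eq_single i (fun j _ hj => ofDegF_apply_of_ne W D.B (by omega) _)
        (fun h => absurd hi h), Finset.sum_eq_single i (fun j _ hj => ofDegF_apply_of_ne W D.B (by omega) _)
        (fun h => absurd hi h), ofDegF_apply_same, ofDegF_apply_same] at this
      exact this
    · rw [Finset.mem_range, not_lt] at hi
      rw [ev_eq_zero_of_lt W D.B (by omega) (x i), ev_eq_zero_of_lt W D.B (by omega) (y i)]
  apply hinj
  rw [evenToFull_ofDeg, ← ha']

end evF

end Summit.Ventures.HodgeRepro2.T6.WeilInst

end
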